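import Summits.BirchSwinnertonDyer.BirchSwinnertonDyer.Theorems.GoldfeldAllTwistsTwoConverseTwinAdditiveTamagawaProduct
import Summits.BirchSwinnertonDyer.BirchSwinnertonDyer.Theorems.Rank2ObservatoryTateDeepCert
import HarnessLib

/-!
# Crux `PrintCf2.SplitBadTwoRankOneOfFacts` (stmt-BirchSwinnertonDyer-20368), road α v10.3 (stub S3c) — brick B16-TAM-7, file 1:
# the members with `7 ∣ d` — `c₇(cm7^{(d)}) = 2` (Kodaira `III*`) and `Tam(W) = 8 · ∏_{ℓ ∣ d, ℓ ∤ 14} (2 | 4)`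

Cell `bsd-print-cf2`, width seat `bsd-line-cf2-p1-w3` g8 (prover-bsd-line-cf2-p1-w3-g8-0). `--supports stmt-BirchSwinnertonDyer-20368`
(helper, Theses-free). HONEST FRAMING: nothing here closes the crux or a registered stub; BSD is not proved by any of this; no summit
statement is proved by this seat. No definition, no named fact, no `sorry`.

WHY. This seat's B16-TAM (p663318, `TamagawaPlaces.card_places_add_two_eq_padicValNat_tamagawaProduct`) translated the odd local kernels of
the control of `𝔖_{v̄}(K*_∞, W*)` into S3c's Tamagawa term for `7 ∤ d` only, because bsd-goldfeld c301's uniform law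
`GoldfeldGoodTwists.tamagawaProduct_eq_of_smul_eq_cm7_quadraticTwist` excludes `7 ∣ d` (the additive cell of twin″ has `7 ∤ d`). S3c quantifies
over ALL squarefree `d ≢ 1 (mod 4)`; this file and its sequel (`…ControlCokernelTamagawaAll`) supply the missing eighth of the class.
WHAT.
* §1 `c₇ = 2` WHEN `7 ∣ d`: over `ℚ₇` the twist parameter `4d = 28·(d/7)` lies in one of the two classes `±28·ℚ₇ˣ²` (`−1` is a non-residue
  mod `7`); the integer models `M_{±7} = (0, ∓21, 0, −1568, ∓21952)` of `X₀(49)^{(±28)}` (c301's cell model at `d = ±7`) pass the Rank2Observatory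
  DEEP Tate certificate `⟨7, ±7, 0, 0, 9, 9, 0⟩` (exit 9 = Step 9: after `x ↦ x ± 7` one has `a₁ = a₂ = a₃ = 0`, `a₄ = −5·7³`, `a₆ = ∓2·7⁵`,
  `7⁹ ∥ Δ`; minimal since `9 < 12`) — **Kodaira type `III*`, `ord₇ Δ_min = 9`** (`kodairaSymbolAt_cellModel_seven_seven`, `…_neg_seven_seven`),
  hence `c₇ = 2` (tree `localTamagawaNumber_eq_two_of_kodairaSymbolAt_eq_IIIstar_holds`) and, by c301's square-class transport
  `localTamagawaNumber_padic_quadraticTwist_eq_of_sq`, **`localTamagawaNumber_padic_cellTwist_seven_of_dvd`**: `c₇(X₀(49)^{(4d)}) = 2` for every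
  squarefree `d` with `7 ∣ d`.
* §2 THE PRODUCT for `7 ∣ d`: `localTamagawaNumber_padic_cellTwist_of_mem_primeFactors_of_dvd` (`4` at `2`, `2` at `7`, `2 | 4` at odd `ℓ ∣ d`,
  `ℓ ≠ 7`, by `(ℓ/7)` — c301's files II/IV) and **`tamagawaProduct_eq_of_smul_eq_cm7_quadraticTwist_of_dvd`**:
  `Tam(W) = 8 · ∏_{ℓ ∈ primeFactors|d| ∖ {2,7}} (2 if (ℓ/7) = −1 else 4)` for every model `W` of `cm7^{(d)}`, `d` squarefree, `d ≢ 1 (mod 4)`, `7 ∣ d`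
  (c301's assembly `tamagawaProduct_cellTwist`, verbatim up to the place `7`).
presearch: Silverman ATAEC IV.9.4 Step 9 / Table 4.1 (type `III*`, `c = 2`), Cremona's tables (49a: `c₇ = 2` throughout the isogeny class) — held
(corpus book:silverman1994-advanced-topics); tree: Rank2Observatory `DeepCert.sound'`, c301 files II/IV/V reused BY NAME. No fact filed. Numerics: the two
certificates were checked by a 20-line integer script before `decide` (v₇: Δ 9, a₄ 3, a₆ 5). beyond-print theorem: no.

References: [Silverman1994] IV.9.4 Steps 6–10, Table 4.1; [SilvermanAEC2009] VII.1 Rem. 1.1, VII.6, X.5 Cor. 5.4; [CremonaAlgorithms1997] Table 1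
(N = 49).
-/

noncomputable section

open scoped Classical NumberField

set_option linter.dupNamespace false
set_option autoImplicit false

open WeierstrassCurve IsDedekindDomain IsLocalRing Rat.HeightOneSpectrum NumberField
  Literature.NumberTheory.EllipticCurves Literature.NumberTheory.EllipticCurves.ModularForms
  Literature.NumberTheory.QuadraticForms
  Summit.BirchSwinnertonDyer.BirchSwinnertonDyer.Rank2Observatory.Tate
  Summit.BirchSwinnertonDyer.BirchSwinnertonDyer.Rank2Observatory.RootNumber
  Summit.BirchSwinnertonDyer.BirchSwinnertonDyer.Theorems.GoldfeldGoodTwists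

namespace Summit.BirchSwinnertonDyer.BirchSwinnertonDyer.Theorems.PrintCf2.TamagawaPlaces

/-! ## §1. The place `7` when `7 ∣ d`: Kodaira type `III*`, `c₇ = 2` -/

section Seven

/-- The DEEP Tate certificate of `M₇ = (0, −21, 0, −1568, −21952)` (`= X₀(49)^{(28)}`) at `7` passes with exit `9` (`III*`):
`(1, 7, 0, 0) • M₇ = (0, 0, 0, −1715, −33614)`, `7³ ∥ a₄`, `7⁵ ∣ a₆`, `7⁹ ∥ Δ`. [cite: Silverman1994, IV.9.4 Step 9] -/
theorem deepCert_check_cellModel_seven :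
    DeepCert.check ⟨7, 7, 0, 0, 9, 9, 0⟩ ⟨0, -3 * 7, 0, -32 * 7 ^ 2, -64 * 7 ^ 3⟩ = true := by
  decide +kernel

/-- Minimality criterion for the same certificate (`n = 9 < 12`). [cite: SilvermanAEC2009, VII.1 Remark 1.1] -/
theorem deepCert_minCrit_cellModel_seven :
    DeepCert.minCrit ⟨7, 7, 0, 0, 9, 9, 0⟩ ⟨0, -3 * 7, 0, -32 * 7 ^ 2, -64 * 7 ^ 3⟩ = true := by
  decide +kernel

/-- The DEEP Tate certificate of `M₋₇ = (0, 21, 0, −1568, 21952)` (`= X₀(49)^{(−28)}`) at `7` passes with exit `9` (`III*`):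
`(1, −7, 0, 0) • M₋₇ = (0, 0, 0, −1715, 33614)`. [cite: Silverman1994, IV.9.4 Step 9] -/
theorem deepCert_check_cellModel_neg_seven :
    DeepCert.check ⟨7, -7, 0, 0, 9, 9, 0⟩ ⟨0, -3 * (-7), 0, -32 * (-7) ^ 2, -64 * (-7) ^ 3⟩ = true := by
  decide +kernel

/-- Minimality criterion for the same certificate (`n = 9 < 12`). [cite: SilvermanAEC2009, VII.1 Remark 1.1] -/
theorem deepCert_minCrit_cellModel_neg_seven :
    DeepCert.minCrit ⟨7, -7, 0, 0, 9, 9, 0⟩ ⟨0, -3 * (-7), 0, -32 * (-7) ^ 2, -64 * (-7) ^ 3⟩ = true := by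
  decide +kernel

/-- **`X₀(49)^{(28)}` has Kodaira type `III*` and `ord₇ Δ_min = 9` at the place above `7`.** [cite: Silverman1994, IV.9.4 Step 9 and Table 4.1] -/
theorem kodairaSymbolAt_cellModel_seven_seven (v : HeightOneSpectrum (𝓞 ℚ)) (hv : natGenerator v = 7) :
    (cm7.quadraticTwist ((4 * (7 : ℤ) : ℤ) : ℚ)).kodairaSymbolAt v = .IIIstar ∧
      (cm7.quadraticTwist ((4 * (7 : ℤ) : ℤ) : ℚ)).ordMinimalDiscriminant v = 9 := by
  have h := DeepCert.sound' (W₀ := ⟨0, -3 * 7, 0, -32 * 7 ^ 2, -64 * 7 ^ 3⟩) (c := ⟨7, 7, 0, 0, 9, 9, 0⟩) v hv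
    deepCert_check_cellModel_seven deepCert_minCrit_cellModel_seven
  rw [cellModel_baseChange] at h
  exact ⟨h.1.trans (by decide), h.2⟩

/-- **`X₀(49)^{(−28)}` has Kodaira type `III*` and `ord₇ Δ_min = 9` at the place above `7`.** [cite: Silverman1994, IV.9.4 Step 9 and Table 4.1] -/
theorem kodairaSymbolAt_cellModel_neg_seven_seven (v : HeightOneSpectrum (𝓞 ℚ)) (hv : natGenerator v = 7) :
    (cm7.quadraticTwist ((4 * (-7 : ℤ) : ℤ) : ℚ)).kodairaSymbolAt v = .IIIstar ∧
      (cm7.quadraticTwist ((4 * (-7 : ℤ) : ℤ) : ℚ)).ordMinimalDiscriminant v = 9 := by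
  have h := DeepCert.sound' (W₀ := ⟨0, -3 * (-7), 0, -32 * (-7) ^ 2, -64 * (-7) ^ 3⟩) (c := ⟨7, -7, 0, 0, 9, 9, 0⟩) v hv
    deepCert_check_cellModel_neg_seven deepCert_minCrit_cellModel_neg_seven
  rw [cellModel_baseChange] at h
  exact ⟨h.1.trans (by decide), h.2⟩

/-- **`c₇(X₀(49)^{(±28)}) = 2`** in Mathlib's `7`-adics (type `III*`, tree `localTamagawaNumber_eq_two_of_kodairaSymbolAt_eq_IIIstar_holds`).
[cite: Silverman1994, IV.9.4 Step 9 and Table 4.1] [cite: CremonaAlgorithms1997, Table 1 (N = 49)] -/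
theorem localTamagawaNumber_padic_cellTwist_seven_of_eq {d : ℤ} (hd : d = 7 ∨ d = -7) :
    (haveI : Fact (Nat.Prime 7) := ⟨by norm_num⟩
     haveI := cm7.isElliptic_quadraticTwist (show (((4 * d : ℤ)) : ℚ) ≠ 0 by
       rcases hd with rfl | rfl <;> norm_num)
     ((cm7.quadraticTwist (((4 * d : ℤ)) : ℚ)).baseChange ℚ_[7]).localTamagawaNumber ℤ_[7]) = 2 := by
  haveI : Fact (Nat.Prime 7) := ⟨by norm_num⟩
  haveI := cm7.isElliptic_quadraticTwist (show (((4 * d : ℤ)) : ℚ) ≠ 0 by rcases hd with rfl | rfl <;> norm_num)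
  set w : HeightOneSpectrum (𝓞 ℚ) := (primesEquiv (R := 𝓞 ℚ)).symm ⟨7, by norm_num⟩ with hw
  have hw7 : (primesEquiv w : ℕ) = 7 := by rw [hw, Equiv.apply_symm_apply]
  have hgen : natGenerator w = 7 := by
    rw [hw]; exact Literature.NumberTheory.GaloisRepresentations.Rat.natGenerator_primesEquiv_symm ⟨7, _⟩
  haveI := perfectField_residueField_adicCompletionIntegers (K := ℚ) w
  rw [localTamagawaNumber_padic_eq_holds _ w 7 hw7]
  refine localTamagawaNumber_eq_two_of_kodairaSymbolAt_eq_IIIstar_holds w _ ?_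
  rcases hd with rfl | rfl
  · exact (kodairaSymbolAt_cellModel_seven_seven w hgen).1
  · exact (kodairaSymbolAt_cellModel_neg_seven_seven w hgen).1

/-- **`c₇(49a1^{(d)}) = 2` for EVERY squarefree `d` with `7 ∣ d`** (Mathlib's `7`-adics, on `X₀(49)^{(4d)} ≅ 49a1^{(d)}`): `d = 7e`, `7 ∤ e`;
`(e/7) = +1` ⇒ `e = θ²` in `ℚ₇` ⇒ `4d = 28·θ²`; `(e/7) = −1` ⇒ `−e = θ²` ⇒ `4d = (−28)·θ²`; both classes have type `III*`, `c₇ = 2` (square-class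
transport, c301 `localTamagawaNumber_padic_quadraticTwist_eq_of_sq`). [cite: SilvermanAEC2009, X.5 Cor. 5.4 and VII.6]
[cite: Silverman1994, IV.9.4 Step 9 and Table 4.1] -/
theorem localTamagawaNumber_padic_cellTwist_seven_of_dvd {d : ℤ} (hsq : Squarefree d) (h7 : (7 : ℤ) ∣ d) :
    (haveI : Fact (Nat.Prime 7) := ⟨by norm_num⟩
     haveI := cm7.isElliptic_quadraticTwist (show (((4 * d : ℤ)) : ℚ) ≠ 0 by
       have := hsq.ne_zero; exact_mod_cast (show (4 * d : ℤ) ≠ 0 by omega))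
     ((cm7.quadraticTwist (((4 * d : ℤ)) : ℚ)).baseChange ℚ_[7]).localTamagawaNumber ℤ_[7]) = 2 := by
  haveI : Fact (Nat.Prime 7) := ⟨by norm_num⟩
  have hd0 : d ≠ 0 := hsq.ne_zero
  have hd : (((4 * d : ℤ)) : ℚ) ≠ 0 := by exact_mod_cast (show (4 * d : ℤ) ≠ 0 by omega)
  obtain ⟨e, hde, he7⟩ := exists_eq_mul_not_dvd_of_squarefree hsq (by norm_num : (7 : ℕ).Prime) (by exact_mod_cast h7)
  have he7' : ¬ (7 : ℤ) ∣ e := by exact_mod_cast he7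
  have he0 : ((e : ℤ) : ZMod 7) ≠ 0 := by
    intro h
    exact he7' ((ZMod.intCast_zmod_eq_zero_iff_dvd e 7).mp h)
  by_cases hsqe : IsSquare ((e : ℤ) : ZMod 7)
  · -- `4d = 28 · θ²`
    obtain ⟨θ, hθ, hθ2⟩ := exists_sq_eq_padic_seven_of_isSquare he7' hsqe
    have hc : (((4 * (7 : ℤ) : ℤ)) : ℚ) ≠ 0 := by norm_num
    have h : ((((4 * d : ℤ)) : ℚ) : ℚ_[7]) = ((((4 * (7 : ℤ) : ℤ)) : ℚ) : ℚ_[7]) * θ ^ 2 := by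
      have : ((e : ℤ) : ℚ_[7]) = θ ^ 2 := by exact_mod_cast hθ2
      rw [hde]; push_cast at this ⊢; rw [this]; ring
    rw [localTamagawaNumber_padic_quadraticTwist_eq_of_sq cm7 hc hd hθ h]
    exact localTamagawaNumber_padic_cellTwist_seven_of_eq (Or.inl rfl)
  · -- `−e` is a square mod `7`, `4d = (−28) · θ²`
    have hsq' : IsSquare (((-e : ℤ)) : ZMod 7) := by
      have h1 : legendreSym 7 e = -1 := (legendreSym.eq_neg_one_iff 7).mpr hsqe
      have h2 : legendreSym 7 (-e) = 1 := by
        rw [show (-e : ℤ) = -1 * e by ring, legendreSym.mul, legendreSym.at_neg_one (by norm_num),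
          ZMod.χ₄_nat_three_mod_four (by norm_num), h1]
        norm_num
      have hres : (((-e : ℤ)) : ZMod 7) ≠ 0 := by rw [Int.cast_neg]; exact neg_ne_zero.mpr he0
      exact (legendreSym.eq_one_iff 7 hres).mp h2
    obtain ⟨θ, hθ, hθ2⟩ := exists_sq_eq_padic_seven_of_isSquare (n := -e) (by rwa [dvd_neg]) hsq'
    have hc : (((4 * (-7 : ℤ) : ℤ)) : ℚ) ≠ 0 := by norm_num
    have h : ((((4 * d : ℤ)) : ℚ) : ℚ_[7]) = ((((4 * (-7 : ℤ) : ℤ)) : ℚ) : ℚ_[7]) * θ ^ 2 := by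
      have : (((-e : ℤ)) : ℚ_[7]) = θ ^ 2 := by exact_mod_cast hθ2
      rw [hde]; push_cast at this ⊢
      linear_combination (-28) * this
    rw [localTamagawaNumber_padic_quadraticTwist_eq_of_sq cm7 hc hd hθ h]
    exact localTamagawaNumber_padic_cellTwist_seven_of_eq (Or.inr rfl)

end Seven

/-! ## §2. The Tamagawa product for `7 ∣ d` -/

section Product

variable {d : ℤ}

/-- The local Tamagawa number of `X₀(49)^{(4d)}` at a prime `p` of `14·|d|` when `7 ∣ d` (`d` squarefree, `d ≢ 1 (mod 4)`): `4` at `2` (c301 file IV),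
`2` at `7` (§1, type `III*`), and `2` / `4` at an odd `ℓ ∣ d`, `ℓ ≠ 7`, according as `(ℓ/7) = −1` / `+1` (c301 file II).
[cite: Silverman1994, IV.9.4 and Table 4.1] -/
theorem localTamagawaNumber_padic_cellTwist_of_mem_primeFactors_of_dvd (hsq : Squarefree d) (hd4 : d % 4 ≠ 1)
    (h7 : (7 : ℤ) ∣ d) {p : ℕ} [hp : Fact p.Prime] (hpmem : p ∈ (14 * d.natAbs).primeFactors) :
    (haveI := cm7.isElliptic_quadraticTwist (show (((4 * d : ℤ)) : ℚ) ≠ 0 by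
       have := hsq.ne_zero; exact_mod_cast (show (4 * d : ℤ) ≠ 0 by omega))
     ((cm7.quadraticTwist (((4 * d : ℤ)) : ℚ)).baseChange ℚ_[p]).localTamagawaNumber ℤ_[p]) =
      if p = 2 then 4 else if p = 7 then 2 else if jacobiSym p 7 = -1 then 2 else 4 := by
  have hpP : p.Prime := hp.out
  have hd0 : d ≠ 0 := hsq.ne_zero
  by_cases hp2 : p = 2
  · subst hp2
    rw [if_pos rfl]
    have e : hp = ⟨Nat.prime_two⟩ := Subsingleton.elim _ _
    subst e
    exact localTamagawaNumber_padic_cellTwist_two hsq hd4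
  rw [if_neg hp2]
  by_cases hp7 : p = 7
  · subst hp7
    rw [if_pos rfl]
    have e : hp = ⟨by norm_num⟩ := Subsingleton.elim _ _
    subst e
    exact localTamagawaNumber_padic_cellTwist_seven_of_dvd hsq h7
  rw [if_neg hp7]
  -- `p` is an odd prime `≠ 7` dividing `14·|d|`, hence dividing `d`
  have hpd : (p : ℤ) ∣ d := by
    have h1 : p ∣ 14 * d.natAbs := Nat.dvd_of_mem_primeFactors hpmem
    rcases (Nat.Prime.dvd_mul hpP).mp h1 with h14 | hdd
    · exfalso
      have : p ∣ 2 * 7 := by norm_num; exact h14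
      rcases (Nat.Prime.dvd_mul hpP).mp this with h | h
      · exact hp2 ((Nat.prime_dvd_prime_iff_eq hpP Nat.prime_two).mp h)
      · exact hp7 ((Nat.prime_dvd_prime_iff_eq hpP (by norm_num)).mp h)
    · exact Int.natCast_dvd.mpr hdd
  have hleg : legendreSym p (-7) = jacobiSym p 7 := legendreSym_neg_seven_eq_jacobiSym hp2
  by_cases hj : jacobiSym p 7 = -1
  · rw [if_pos hj]
    exact localTamagawaNumber_padic_cellModel_eq_two hsq hd4 hp2 hp7 hpd (by rw [hleg, hj])
  · rw [if_neg hj]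
    have hj1 : jacobiSym p 7 = 1 := by
      rcases jacobiSym.eq_one_or_neg_one (a := (p : ℤ)) (b := 7) (by
        rw [Int.gcd_natCast_natCast]
        exact (Nat.coprime_primes hpP (by norm_num)).mpr hp7) with h | h
      · exact h
      · exact (hj h).elim
    exact localTamagawaNumber_padic_cellModel_eq_four hsq hd4 hp2 hp7 hpd (by rw [hleg, hj1])

/-- **TAMAGAWA PRODUCT LAW for `7 ∣ d`.** For squarefree `d ≢ 1 (mod 4)` with `7 ∣ d`:
`Tam(X₀(49)^{(4d)}) = 8 · ∏_{ℓ ∈ primeFactors |d| ∖ {2, 7}} (2 if (ℓ/7) = −1 else 4)` — `c₂·c₇ = 4·2` (the `7` now among the primes of `d`, type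
`III*` instead of `III`) times `2` per inert and `4` per split odd prime factor `ℓ ≠ 7` of `d`. c301's `tamagawaProduct_cellTwist` verbatim up to
the bookkeeping of the place `7`. [cite: Silverman1994, IV.9.4 and Table 4.1] [cite: SilvermanAEC2009, VII.6] -/
theorem tamagawaProduct_cellTwist_of_dvd (hsq : Squarefree d) (hd4 : d % 4 ≠ 1) (h7 : (7 : ℤ) ∣ d) :
    (haveI := cm7.isElliptic_quadraticTwist (show (((4 * d : ℤ)) : ℚ) ≠ 0 by
       have := hsq.ne_zero; exact_mod_cast (show (4 * d : ℤ) ≠ 0 by omega))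
     (cm7.quadraticTwist (((4 * d : ℤ)) : ℚ)).tamagawaProduct) =
      8 * ∏ l ∈ ((d.natAbs.primeFactors.erase 2).erase 7), (if jacobiSym l 7 = -1 then 2 else 4) := by
  have hd0 : d ≠ 0 := hsq.ne_zero
  have hd : (((4 * d : ℤ)) : ℚ) ≠ 0 := by exact_mod_cast (show (4 * d : ℤ) ≠ 0 by omega)
  haveI := cm7.isElliptic_quadraticTwist hd
  -- the finite set of places of `14·|d|`
  set P : Finset ℕ := (14 * d.natAbs).primeFactors with hP
  have hPprime : ∀ p ∈ P, p.Prime := fun p hp ↦ Nat.prime_of_mem_primeFactors hp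
  set e : P → HeightOneSpectrum ℤ := fun p ↦ (primesEquiv (R := ℤ)).symm ⟨p.1, hPprime p.1 p.2⟩ with he
  have he_inj : Function.Injective e := by
    intro p q hpq
    have := congrArg (fun v ↦ ((primesEquiv (R := ℤ)) v : ℕ)) hpq
    simp only [he, Equiv.apply_symm_apply] at this
    exact Subtype.ext this
  have he_val : ∀ p : P, (primesEquiv (e p) : ℕ) = p.1 := fun p ↦ by simp only [he, Equiv.apply_symm_apply]
  set s : Finset (HeightOneSpectrum ℤ) := Finset.univ.image e with hs
  -- every bad place is in `s`
  have hprod := tamagawaProduct_eq_prod (cm7.quadraticTwist (((4 * d : ℤ)) : ℚ)) s (by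
    intro v hv
    by_contra hmem
    apply hv
    rw [← cellModel_baseChange]
    refine hasGoodReductionAt_of_not_dvd fun hdvd ↦ hmem ?_
    have hmemP : natGenerator v ∈ P := by
      rw [hP, Nat.mem_primeFactors]
      refine ⟨prime_natGenerator v, ?_, by positivity⟩
      rcases dvd_of_prime_dvd_cellModel_Δ (prime_natGenerator v) hdvd with h | h | h
      · rw [h]; exact dvd_mul_of_dvd_left (by norm_num) _
      · rw [h]; exact dvd_mul_of_dvd_left (by norm_num) _
      · exact dvd_mul_of_dvd_right (Int.natCast_dvd.mp h) _
    rw [hs, Finset.mem_image]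
    refine ⟨⟨natGenerator v, hmemP⟩, Finset.mem_univ _, ?_⟩
    apply (primesEquiv (R := ℤ)).injective
    rw [he]; simp only [Equiv.apply_symm_apply]
    exact Subtype.ext rfl)
  rw [hprod, hs, Finset.prod_image (fun p _ q _ h ↦ he_inj h)]
  -- evaluate each local factor
  have hfac : ∀ p : P, (haveI := Fact.mk (primesEquiv (e p)).2
      ((cm7.quadraticTwist (((4 * d : ℤ)) : ℚ)).baseChange ℚ_[primesEquiv (e p)]).localTamagawaNumber
        ℤ_[primesEquiv (e p)]) = (if p.1 = 2 then 4 else if p.1 = 7 then 2 else if jacobiSym p.1 7 = -1 then 2 else 4) := by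
    intro p
    haveI : Fact p.1.Prime := ⟨hPprime p.1 p.2⟩
    refine localTamagawaNumber_padic_eq_of_forall_place _ (e p) p.1 (he_val p) _ (fun w hw ↦ ?_)
    rw [← localTamagawaNumber_padic_eq_holds _ w p.1 hw]
    exact localTamagawaNumber_padic_cellTwist_of_mem_primeFactors_of_dvd hsq hd4 h7 p.2
  rw [Finset.prod_congr rfl (fun p _ ↦ hfac p)]
  -- back to a product over `P = {2, 7} ∪ (primeFactors |d| \ {2, 7})`
  rw [Finset.prod_coe_sort P
    (fun p : ℕ ↦ (if p = 2 then 4 else if p = 7 then 2 else if jacobiSym p 7 = -1 then 2 else 4 : ℕ))]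
  have h2P : (2 : ℕ) ∉ insert 7 ((d.natAbs.primeFactors.erase 2).erase 7) := by
    simp [Finset.mem_insert, Finset.mem_erase]
  have h7Q : (7 : ℕ) ∉ (d.natAbs.primeFactors.erase 2).erase 7 := Finset.notMem_erase 7 _
  have hPeq : P = insert 2 (insert 7 ((d.natAbs.primeFactors.erase 2).erase 7)) := by
    ext p
    rw [hP, Finset.mem_insert, Finset.mem_insert, Finset.mem_erase, Finset.mem_erase, Nat.mem_primeFactors,
      Nat.mem_primeFactors]
    constructor
    · rintro ⟨hp, hdvd, -⟩
      by_cases hp2 : p = 2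
      · exact Or.inl hp2
      by_cases hp7 : p = 7
      · exact Or.inr (Or.inl hp7)
      refine Or.inr (Or.inr ⟨hp7, hp2, hp, ?_, Int.natAbs_ne_zero.mpr hd0⟩)
      rcases (Nat.Prime.dvd_mul hp).mp hdvd with h14 | hdd
      · exfalso
        have : p ∣ 2 * 7 := by norm_num; exact h14
        rcases (Nat.Prime.dvd_mul hp).mp this with h | h
        · exact hp2 ((Nat.prime_dvd_prime_iff_eq hp Nat.prime_two).mp h)
        · exact hp7 ((Nat.prime_dvd_prime_iff_eq hp (by norm_num)).mp h)
      · exact hdd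
    · rintro (rfl | rfl | ⟨-, -, hp, hdvd, -⟩)
      · exact ⟨Nat.prime_two, dvd_mul_of_dvd_left (by norm_num) _, by positivity⟩
      · exact ⟨by norm_num, dvd_mul_of_dvd_left (by norm_num) _, by positivity⟩
      · exact ⟨hp, dvd_mul_of_dvd_right hdvd _, by positivity⟩
  rw [hPeq, Finset.prod_insert h2P, Finset.prod_insert h7Q, if_pos rfl, if_neg (by norm_num), if_pos rfl]
  rw [show (4 : ℕ) * (2 * ∏ p ∈ (d.natAbs.primeFactors.erase 2).erase 7,
      (if p = 2 then 4 else if p = 7 then 2 else if jacobiSym p 7 = -1 then 2 else 4)) =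
      8 * ∏ p ∈ (d.natAbs.primeFactors.erase 2).erase 7,
      (if p = 2 then 4 else if p = 7 then 2 else if jacobiSym p 7 = -1 then 2 else 4) by ring]
  congr 1
  refine Finset.prod_congr rfl fun p hp ↦ ?_
  have hp7 : p ≠ 7 := (Finset.mem_erase.mp hp).1
  have hp2 : p ≠ 2 := (Finset.mem_erase.mp (Finset.mem_erase.mp hp).2).1
  rw [if_neg hp2, if_neg hp7]

/-- **`∏_p c_p(W) = 8 · ∏_{ℓ ∣ d, ℓ ∤ 14} c_ℓ` FOR EVERY MODEL `W` of `cm7^{(d)}` with `7 ∣ d`** (`C • W = X₀(49)^{(d)}`, `d` squarefree,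
`d ≢ 1 (mod 4)`): `Tam` is a `ℚ`-isomorphism invariant and `X₀(49)^{(d)} ≅ X₀(49)^{(4d)}` (c301 `exists_smul_eq_cellModel_baseChange`).
[cite: Silverman1994, IV.9.4 and Table 4.1] [cite: SilvermanAEC2009, VII.6 and X.5 Cor. 5.4] -/
theorem tamagawaProduct_eq_of_smul_eq_cm7_quadraticTwist_of_dvd (hsq : Squarefree d) (hd4 : d % 4 ≠ 1)
    (h7 : (7 : ℤ) ∣ d) (W : WeierstrassCurve ℚ) [W.IsElliptic] (C : VariableChange ℚ)
    (hC : C • W = cm7.quadraticTwist (d : ℚ)) :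
    W.tamagawaProduct = 8 * ∏ l ∈ ((d.natAbs.primeFactors.erase 2).erase 7), (if jacobiSym l 7 = -1 then 2 else 4) := by
  have hd : (((4 * d : ℤ)) : ℚ) ≠ 0 := by
    have := hsq.ne_zero; exact_mod_cast (show (4 * d : ℤ) ≠ 0 by omega)
  haveI := cm7.isElliptic_quadraticTwist hd
  obtain ⟨C', hC'⟩ := exists_smul_eq_cellModel_baseChange W hC
  rw [cellModel_baseChange] at hC'
  have h := tamagawaProduct_variableChange_eq W C'
  rw [hC'] at h
  rw [← h]
  exact tamagawaProduct_cellTwist_of_dvd hsq hd4 h7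

end Product

end Summit.BirchSwinnertonDyer.BirchSwinnertonDyer.Theorems.PrintCf2.TamagawaPlaces

end
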